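import Literature.Probability.LatticeModels.ManeuverChain
import Literature.Probability.LatticeModels.RectangleExit
import Literature.Probability.LatticeModels.LatticeWalkCrossing
import HarnessLib

/-!
# The annulus maneuver: the one-scale weak Beurling estimate on `ℤ²`

Topic `Literature/Probability/LatticeModels`; an instalment (item P5 of the road recorded in
`Sweep1Proofs.lean`, module docstring §2b) of the discharge programme for crit-ising.S18 /
Smirnov's Theorem 2.2: the one-scale form of the weak Beurling estimate (Smirnov 2010, Lemma B.2
= Lemma 7.2 of arXiv:0708.0039, "found in Kesten's [Kes87]"), proved analytically. Statement
(`maneuverConst_le_killedIn`): if `K ⊆ ℤ²` is hole-free (`HoleFree`), `S ⊆ K`, and some face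
`F₀ ∉ K` lies within sup-distance `12k` of `c`, then at every `x` within `12k` of `c` the solution
of the Dirichlet problem on `S ∩ [c-48k, c+48k]²` with data `1` on `Sᶜ` and `0` outside the box is
at least a universal constant `maneuverConst > 0` — the walk from `x` killed on `Sᶜ` dies before
reaching sup-distance `48k` with probability `≥ c_*`.

Proof. A twelve-step maneuver of rectangles (`maneuver`: units of `k`; two connectors into the
top-left corner, a left–right crossing of the top strip `[-36,36]k × [12,36]k`, two connectors, a
top–bottom crossing of the right strip, …, a bottom–top crossing of the left strip; landing sets =
middle halves of exit sides, start sets = transverse middle thirds at depth `≥ k`; the design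
checks `L i ⊆ T (i+1)` etc. are verified by `omega`). (II) The free chain satisfies
`M ≥ c_* = ∏ c_i` on the start box by the one-step bound of `RectangleExit.lean`
(`tailConst_le_chainM`; the constants are scale-free, `exitConst_scale`). (III) `M - N ≤ killedIn`
(`ManeuverChain.lean`). (I) `N = 0` on the start box: a positive `N` yields walks in `S`
performing the maneuver (`exists_crossings_of_chainN_pos`), in particular transversal crossings of
the four frame strips, while `F₀` escapes to infinity through `Kᶜ` (`HoleFree`) and its escape
path crosses one of the strips the other way (`exists_strip_crossing`), meeting the maneuver at a
site of `S ∩ Kᶜ = ∅` (`Percolation.exists_mem_support_of_crossing`) — `false_of_crossings`.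
Everything is proved.

## References

* S. Smirnov, Ann. of Math. 172 (2010) 1435–1467, App. B, Lemma B.2 — bib key `Smirnov2010`.
* H. Kesten, Hitting probabilities of random walks on `ℤ^d`, Stoch. Proc. Appl. 25 (1987) 165–184.
-/

noncomputable section

namespace Literature.Probability.LatticeModels

open Set SimpleGraph

/-! ### Steps of the maneuver -/

/-- One step of the maneuver, in units of `k` relative to the centre `c`: the rectangle
`[α, α + w] × [β, β + h]` (times `k`, plus `c`) and its exit side
(`0` right, `1` top, `2` left, `3` bottom). [folklore] -/
structure MStep where
  /-- abscissa of the lower-left corner, in units of `k` -/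
  α : ℤ
  /-- ordinate of the lower-left corner, in units of `k` -/
  β : ℤ
  /-- width in units of `k` -/
  w : ℕ
  /-- height in units of `k` -/
  h : ℕ
  /-- exit side: `0` right, `1` top, `2` left, `3` bottom -/
  side : Fin 4

namespace MStep

variable (s : MStep) (c : Site 2) (k : ℕ)

/-- The lower-left corner. [folklore] -/
def corner : Site 2 := ![c 0 + s.α * k, c 1 + s.β * k]

/-- The open rectangle of the step. [folklore] -/
def U : Set (Site 2) := rectInterior (s.corner c k) (s.w * k) (s.h * k)

/-- The landing set: the middle half of the exit side. [folklore] -/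
def L : Set (Site 2) :=
  {x | (s.side = 0 ∧ x 0 = c 0 + s.α * k + s.w * k ∧ (s.h * k : ℤ) ≤ 4 * (x 1 - (c 1 + s.β * k)) ∧ 4 * (x 1 - (c 1 + s.β * k)) ≤ 3 * (s.h * k)) ∨
       (s.side = 1 ∧ x 1 = c 1 + s.β * k + s.h * k ∧ (s.w * k : ℤ) ≤ 4 * (x 0 - (c 0 + s.α * k)) ∧ 4 * (x 0 - (c 0 + s.α * k)) ≤ 3 * (s.w * k)) ∨
       (s.side = 2 ∧ x 0 = c 0 + s.α * k ∧ (s.h * k : ℤ) ≤ 4 * (x 1 - (c 1 + s.β * k)) ∧ 4 * (x 1 - (c 1 + s.β * k)) ≤ 3 * (s.h * k)) ∨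
       (s.side = 3 ∧ x 1 = c 1 + s.β * k ∧ (s.w * k : ℤ) ≤ 4 * (x 0 - (c 0 + s.α * k)) ∧ 4 * (x 0 - (c 0 + s.α * k)) ≤ 3 * (s.w * k))}

/-- The start set: inside the rectangle, transverse middle third, depth at least `k` from the
far side. [folklore] -/
def T : Set (Site 2) :=
  {x | x ∈ s.U c k ∧
    ((s.side = 0 ∧ (s.h * k : ℤ) ≤ 3 * (x 1 - (c 1 + s.β * k)) ∧ 3 * (x 1 - (c 1 + s.β * k)) ≤ 2 * (s.h * k) ∧ (k : ℤ) ≤ x 0 - (c 0 + s.α * k)) ∨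
     (s.side = 1 ∧ (s.w * k : ℤ) ≤ 3 * (x 0 - (c 0 + s.α * k)) ∧ 3 * (x 0 - (c 0 + s.α * k)) ≤ 2 * (s.w * k) ∧ (k : ℤ) ≤ x 1 - (c 1 + s.β * k)) ∨
     (s.side = 2 ∧ (s.h * k : ℤ) ≤ 3 * (x 1 - (c 1 + s.β * k)) ∧ 3 * (x 1 - (c 1 + s.β * k)) ≤ 2 * (s.h * k) ∧ (k : ℤ) ≤ c 0 + s.α * k + s.w * k - x 0) ∨
     (s.side = 3 ∧ (s.w * k : ℤ) ≤ 3 * (x 0 - (c 0 + s.α * k)) ∧ 3 * (x 0 - (c 0 + s.α * k)) ≤ 2 * (s.w * k) ∧ (k : ℤ) ≤ c 1 + s.β * k + s.h * k - x 1))}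

/-- The exit constant of the step (independent of `k`, see `const_eq`). [folklore] -/
def const : ℝ := if s.side = 0 ∨ s.side = 2 then exitConst s.h s.w 1 else exitConst s.w s.h 1

/-- Scaling: `exitConst (w k) (h k) k = exitConst w h 1`. [folklore] -/
theorem exitConst_scale {w h k : ℕ} (hw : 0 < w) (hk : 0 < k) : exitConst (w * k) (h * k) k = exitConst w h 1 := by
  unfold exitConst
  have hk' : (k : ℝ) ≠ 0 := by exact_mod_cast hk.ne'
  have hw' : (w : ℝ) ≠ 0 := by exact_mod_cast hw.ne'
  push_cast
  congr 1
  · congr 1; field_simp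
  · congr 1; field_simp

/-- The step constant is positive (for positive dimensions). [folklore] -/
theorem const_pos (hw : 0 < s.w) (hh : 0 < s.h) : 0 < s.const := by
  unfold const; split_ifs
  · exact exitConst_pos hh one_pos
  · exact exitConst_pos hw one_pos

/-- **The one-step lower bound for a maneuver step**: a function harmonic on the step's rectangle,
nonnegative off it… precisely: `u = harmExt (U) g` with `g ≥ 0` everywhere and `g ≥ m` on the
landing set; then `u ≥ m · const` on the start set. [folklore] -/
theorem lower_bound (hk : 0 < k) (hw : 8 ≤ s.w) (hh : 8 ≤ s.h) {g : Site 2 → ℝ} (hg : ∀ w, 0 ≤ g w) {m : ℝ} (hm : 0 ≤ m)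
    (hgL : ∀ w ∈ s.L c k, m ≤ g w) {x : Site 2} (hx : x ∈ s.T c k) :
    m * s.const ≤ harmExt (s.U c k) g x := by
  have hfin : (s.U c k).Finite := rectInterior_finite _ _ _
  set u := harmExt (s.U c k) g with hu
  have hharm : IsLatticeHarmonicOn u (rectInterior (s.corner c k) (s.w * k) (s.h * k)) := harmExt_harmonicOn hfin g
  have hframe : ∀ w, OnFrame (s.corner c k) (s.w * k) (s.h * k) w → 0 ≤ u w := by
    intro w hw
    have hwU : w ∉ s.U c k := by
      simp only [U, rectInterior, Set.mem_setOf_eq, not_and, not_lt]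
      rcases hw with ⟨h0 | h0, -, -⟩ | ⟨h1 | h1, -, -⟩ <;> intros <;> omega
    rw [hu, harmExt_of_not_mem hfin g hwU]; exact hg w
  have hval : ∀ w ∈ s.L c k, m ≤ u w := by
    intro w hw
    have hwU : w ∉ s.U c k := by
      simp only [U, rectInterior, Set.mem_setOf_eq, not_and, not_lt, corner, Matrix.cons_val_zero, Matrix.cons_val_one]
      simp only [L, Set.mem_setOf_eq] at hw
      rcases hw with ⟨-, h, -⟩ | ⟨-, h, -⟩ | ⟨-, h, -⟩ | ⟨-, h, -⟩ <;> intros <;> push_cast at * <;> omega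
    rw [hu, harmExt_of_not_mem hfin g hwU]; exact hgL w hw
  have hwk : 4 ≤ s.w * k := le_trans (by omega) (Nat.mul_le_mul hw hk)
  have hhk : 4 ≤ s.h * k := le_trans (by omega) (Nat.mul_le_mul hh hk)
  have hwk0 : 0 < s.w * k := by omega
  have hhk0 : 0 < s.h * k := by omega
  have hc0 : (s.corner c k) 0 = c 0 + s.α * k := rfl
  have hc1 : (s.corner c k) 1 = c 1 + s.β * k := rfl
  obtain ⟨hxU, hxT⟩ := hx
  have hxU' : x ∈ rectInterior (s.corner c k) (s.w * k) (s.h * k) := hxU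
  rcases hxT with ⟨hs, h1, h2, h3⟩ | ⟨hs, h1, h2, h3⟩ | ⟨hs, h1, h2, h3⟩ | ⟨hs, h1, h2, h3⟩
  · -- right
    have key := exit_right (s.corner c k) hhk hwk0 hharm hframe hm (fun w hw0 hw1 hw2 => hval w ?_) hxU'
      (by rw [hc1]; push_cast; exact h1) (by rw [hc1]; push_cast; exact h2) (d := k) (by rw [hc0]; exact h3)
    · rw [const, if_pos (Or.inl hs), ← exitConst_scale (by omega) hk]; exact key
    · simp only [L, Set.mem_setOf_eq]; left
      rw [hc0] at hw0; rw [hc1] at hw1 hw2; push_cast at hw0 hw1 hw2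
      exact ⟨hs, hw0, hw1, hw2⟩
  · -- top
    have key := exit_top (s.corner c k) hwk hhk0 hharm hframe hm (fun w hw0 hw1 hw2 => hval w ?_) hxU'
      (by rw [hc0]; push_cast; exact h1) (by rw [hc0]; push_cast; exact h2) (d := k) (by rw [hc1]; exact h3)
    · rw [const, if_neg (by rw [hs]; decide), ← exitConst_scale (by omega) hk]; exact key
    · simp only [L, Set.mem_setOf_eq]; right; left
      rw [hc1] at hw0; rw [hc0] at hw1 hw2; push_cast at hw0 hw1 hw2
      exact ⟨hs, hw0, hw1, hw2⟩
  · -- left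
    have key := exit_left (s.corner c k) hhk hwk0 hharm hframe hm (fun w hw0 hw1 hw2 => hval w ?_) hxU'
      (by rw [hc1]; push_cast; exact h1) (by rw [hc1]; push_cast; exact h2) (d := k) (by rw [hc0]; push_cast; exact h3)
    · rw [const, if_pos (Or.inr hs), ← exitConst_scale (by omega) hk]; exact key
    · simp only [L, Set.mem_setOf_eq]; right; right; left
      rw [hc0] at hw0; rw [hc1] at hw1 hw2; push_cast at hw0 hw1 hw2
      exact ⟨hs, hw0, hw1, hw2⟩
  · -- bottom
    have key := exit_bottom (s.corner c k) hwk hhk0 hharm hframe hm (fun w hw0 hw1 hw2 => hval w ?_) hxU'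
      (by rw [hc0]; push_cast; exact h1) (by rw [hc0]; push_cast; exact h2) (d := k) (by rw [hc1]; push_cast; exact h3)
    · rw [const, if_neg (by rw [hs]; decide), ← exitConst_scale (by omega) hk]; exact key
    · simp only [L, Set.mem_setOf_eq]; right; right; right
      rw [hc1] at hw0; rw [hc0] at hw1 hw2; push_cast at hw0 hw1 hw2
      exact ⟨hs, hw0, hw1, hw2⟩

end MStep

/-! ### The twelve steps -/

/-- **The maneuver** (units of `k`, centre `c`): from the start box `[-12, 12]²` go left and up
into the top-left corner region, cross the top strip `[-36, 36] × [12, 36]` left to right, turn,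
cross the right strip top to bottom, turn, cross the bottom strip right to left, turn, cross the
left strip bottom to top; all inside `[-48, 48]²`. Landing sets are middle halves of exit sides,
start sets transverse middle thirds, and each landing set lies in the next start set. [folklore] -/
def maneuver : Fin 12 → MStep :=
  ![⟨-41, -44, 88, 88, 2⟩, ⟨-47, -48, 12, 72, 1⟩, ⟨-46, 12, 86, 24, 0⟩,
    ⟨36, 6, 8, 35, 1⟩, ⟨24, 37, 22, 8, 2⟩, ⟨12, -40, 24, 86, 3⟩,
    ⟨6, -44, 35, 8, 0⟩, ⟨37, -46, 8, 22, 1⟩, ⟨-40, -36, 86, 24, 2⟩,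
    ⟨-44, -41, 8, 35, 3⟩, ⟨-46, -45, 22, 8, 0⟩, ⟨-36, -46, 24, 86, 1⟩]

section Geometry

variable (c : Site 2) (k : ℕ)

/-- Rectangles of the maneuver (empty beyond the twelfth). [folklore] -/
def mU (i : ℕ) : Set (Site 2) := if h : i < 12 then (maneuver ⟨i, h⟩).U c k else ∅

/-- Landing sets of the maneuver. [folklore] -/
def mL (i : ℕ) : Set (Site 2) := if h : i < 12 then (maneuver ⟨i, h⟩).L c k else ∅

/-- Start sets of the maneuver (everything beyond the twelfth). [folklore] -/
def mT (i : ℕ) : Set (Site 2) := if h : i < 12 then (maneuver ⟨i, h⟩).T c k else Set.univ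

/-- The region of the maneuver: the closed box of radius `48k`. [folklore] -/
def mW : Set (Site 2) := {x | |x 0 - c 0| ≤ 48 * k ∧ |x 1 - c 1| ≤ 48 * k}

/-- The start box of radius `12k`. [folklore] -/
def mB : Set (Site 2) := {x | |x 0 - c 0| ≤ 12 * k ∧ |x 1 - c 1| ≤ 12 * k}

/-- The region is finite. [folklore] -/
theorem mW_finite : (mW c k).Finite := by
  have h : mW c k ⊆ (fun p : ℤ × ℤ => (![p.1, p.2] : Site 2)) ''
      (Set.Icc (c 0 - 48 * k) (c 0 + 48 * k) ×ˢ Set.Icc (c 1 - 48 * k) (c 1 + 48 * k)) := by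
    intro x hx
    obtain ⟨h0, h1⟩ := hx
    rw [abs_le] at h0 h1
    refine ⟨(x 0, x 1), ⟨⟨by linarith, by linarith⟩, ⟨by linarith, by linarith⟩⟩, ?_⟩
    ext i; fin_cases i <;> rfl
  exact ((Set.finite_Icc _ _).prod (Set.finite_Icc _ _)).image _ |>.subset h

/-- The rectangles are finite. [folklore] -/
theorem mU_finite (i : ℕ) : (mU c k i).Finite := by
  unfold mU; split_ifs
  · exact rectInterior_finite _ _ _
  · exact Set.finite_empty

variable {c k}

/-- **Design check: each landing set lies in the next start set.** [folklore] -/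
theorem mL_subset_mT (hk : 0 < k) {i : ℕ} (hi : i < 12) : mL c k i ⊆ mT c k (i + 1) := by
  intro x hx
  interval_cases i <;>
    simp only [mL, mT, maneuver, MStep.L, MStep.T, MStep.U, MStep.corner, rectInterior, Set.mem_setOf_eq,
      Matrix.cons_val_zero, Matrix.cons_val_one,
      show (11 : ℕ) + 1 < 12 ↔ False by decide, dite_false, Set.mem_univ] at hx ⊢ <;>
    simp at hx ⊢ <;> omega

/-- **Design check: the start box lies in the first start set.** [folklore] -/
theorem mB_subset_mT_zero (hk : 0 < k) : mB c k ⊆ mT c k 0 := by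
  intro x hx
  obtain ⟨h0, h1⟩ := hx
  rw [abs_le] at h0 h1
  simp only [mT, maneuver, MStep.T, MStep.U, MStep.corner, rectInterior, Set.mem_setOf_eq,
    Matrix.cons_val_zero, Matrix.cons_val_one, show (0 : ℕ) < 12 by decide, dite_true]
  simp
  omega

/-- Start sets lie in their rectangles. [folklore] -/
theorem mT_subset_mU {i : ℕ} (hi : i < 12) : mT c k i ⊆ mU c k i := by
  intro x hx
  simp only [mT, mU, dif_pos hi] at hx ⊢
  exact hx.1

/-- **Design check: the rectangles lie in the region.** [folklore] -/
theorem mU_subset_mW (i : ℕ) : mU c k i ⊆ mW c k := by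
  intro x hx
  by_cases hi : i < 12
  · simp only [mW, Set.mem_setOf_eq, abs_le]
    interval_cases i <;>
      simp only [mU, maneuver, MStep.U, MStep.corner, rectInterior,
        Matrix.cons_val_zero, Matrix.cons_val_one] at hx <;>
      simp at hx <;> omega
  · simp [mU, hi] at hx

/-- **Design check: the landing sets lie in the region.** [folklore] -/
theorem mL_subset_mW (hk : 0 < k) (i : ℕ) : mL c k i ⊆ mW c k := by
  intro x hx
  by_cases hi : i < 12
  · simp only [mW, Set.mem_setOf_eq, abs_le]
    interval_cases i <;>
      simp only [mL, maneuver, MStep.L] at hx <;>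
      simp at hx <;> omega
  · simp [mL, hi] at hx

/-- **Design check: landing sets are disjoint from their (open) rectangles.** [folklore] -/
theorem disjoint_mU_mL (i : ℕ) : Disjoint (mU c k i) (mL c k i) := by
  rw [Set.disjoint_left]
  intro x hxU hxL
  by_cases hi : i < 12
  · interval_cases i <;>
      simp only [mU, mL, maneuver, MStep.L, MStep.U, MStep.corner, rectInterior,
        Matrix.cons_val_zero, Matrix.cons_val_one] at hxU hxL <;>
      simp at hxU hxL <;> omega
  · simp [mU, hi] at hxU

/-- The start box lies in the region. [folklore] -/
theorem mB_subset_mW : mB c k ⊆ mW c k := by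
  intro x hx; obtain ⟨h0, h1⟩ := hx
  exact ⟨h0.trans (by gcongr; norm_num), h1.trans (by gcongr; norm_num)⟩

/-! ### The free chain is bounded below on the start box -/

/-- The constant of step `i` (`1` beyond the twelfth). [folklore] -/
def stepConst (i : ℕ) : ℝ := if h : i < 12 then (maneuver ⟨i, h⟩).const else 1

/-- The step constants are positive. [folklore] -/
theorem stepConst_pos (i : ℕ) : 0 < stepConst i := by
  unfold stepConst; split_ifs with h
  · apply MStep.const_pos <;> interval_cases i <;> simp [maneuver]
  · exact one_pos

/-- **The maneuver constant** `c_* = ∏_{i<12} c_i > 0` (a universal constant). [folklore] -/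
def maneuverConst : ℝ := ∏ i ∈ Finset.range 12, stepConst i

/-- The maneuver constant is positive. [folklore] -/
theorem maneuverConst_pos : 0 < maneuverConst := Finset.prod_pos fun i _ => stepConst_pos i

/-- The tail products `∏_{i ≤ j < 12} c_j`. [folklore] -/
def tailConst (i : ℕ) : ℝ := ∏ j ∈ Finset.Ico i 12, stepConst j

/-- Tail products are positive. [folklore] -/
theorem tailConst_pos (i : ℕ) : 0 < tailConst i := Finset.prod_pos fun j _ => stepConst_pos j

/-- `tailConst i = c_i · tailConst (i+1)` for `i < 12`. [folklore] -/
theorem tailConst_succ {i : ℕ} (hi : i < 12) : tailConst i = stepConst i * tailConst (i + 1) := by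
  unfold tailConst
  rw [Finset.prod_eq_prod_Ico_succ_bot hi]

/-- **The free chain is at least the tail product on the start sets**: by downward induction
with the one-step lower bound and the design check `L i ⊆ T (i+1)`. [folklore] -/
theorem tailConst_le_chainM (hk : 0 < k) {j : ℕ} (hj : j ≤ 12) {x : Site 2} (hx : x ∈ mT c k (12 - j)) :
    tailConst (12 - j) ≤ chainM (mU c k) (mL c k) 12 j x := by
  classical
  induction j generalizing x with
  | zero => simp [tailConst, chainM]
  | succ j ih =>
    have hi : 12 - (j + 1) < 12 := by omega
    set i := 12 - (j + 1) with hidef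
    have hi' : 12 - 1 - j = i := by omega
    have hsucc : 12 - j = i + 1 := by omega
    simp only [chainM, hi']
    rw [tailConst_succ hi]
    -- the data `g = 1_{L i} · M_j`
    have hM0 : ∀ w, 0 ≤ chainM (mU c k) (mL c k) 12 j w := fun w => (chainM_mem_Icc (mU_finite c k) j w).1
    have hT : ∀ w ∈ mL c k i, tailConst (i + 1) ≤ chainM (mU c k) (mL c k) 12 j w := by
      intro w hw
      have := ih (by omega) (x := w) (by rw [hsucc]; exact mL_subset_mT hk hi hw)
      rwa [hsucc] at this
    have key := MStep.lower_bound (maneuver ⟨i, hi⟩) c k hk (by interval_cases i <;> simp [maneuver])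
      (by interval_cases i <;> simp [maneuver])
      (g := fun w => if w ∈ mL c k i then chainM (mU c k) (mL c k) 12 j w else 0)
      (fun w => by split_ifs <;> [exact hM0 w; exact le_rfl]) (tailConst_pos (i + 1)).le
      (fun w hw => by
        have hw' : w ∈ mL c k i := by simp only [mL, dif_pos hi]; exact hw
        simp only [hw', if_true]; exact hT w hw') (x := x) (by simp only [mT, dif_pos hi] at hx; exact hx)
    rw [mul_comm]
    have hU : (maneuver ⟨i, hi⟩).U c k = mU c k i := by simp only [mU, dif_pos hi]
    have hc : (maneuver ⟨i, hi⟩).const = stepConst i := by simp only [stepConst, dif_pos hi]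
    rw [hU, hc] at key
    exact key

/-- **`M ≥ c_*` on the start box.** [folklore] -/
theorem maneuverConst_le_chainM (hk : 0 < k) {x : Site 2} (hx : x ∈ mB c k) :
    maneuverConst ≤ chainM (mU c k) (mL c k) 12 12 x := by
  have h := tailConst_le_chainM hk le_rfl (x := x) (mB_subset_mT_zero hk hx)
  have e : tailConst (12 - 12) = maneuverConst := by
    simp only [Nat.sub_self, tailConst, maneuverConst, Finset.range_eq_Ico]
  rw [e] at h; exact h

/-- `c_* ≤ 1`. [folklore] -/
theorem maneuverConst_le_one : maneuverConst ≤ 1 := by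
  have h := maneuverConst_le_chainM (c := 0) (k := 1) one_pos (x := 0) (by simp [mB])
  exact h.trans (chainM_mem_Icc (mU_finite 0 1) 12 0).2

/-! ### A positive killed chain forces four strip crossings inside `S` -/

variable {S : Set (Site 2)}

/-- One step of the killed maneuver inside `S` (wrapper of `exists_walk_of_chainN_pos`). [folklore] -/
theorem iter_step {i : ℕ} (hi : i < 12) {y : Site 2} (hy : y ∈ mU c k i) (hyS : y ∈ S)
    (hpos : 0 < chainN (mU c k) (mL c k) S 12 (12 - i) y) :
    ∃ y', y' ∈ mL c k i ∧ y' ∈ S ∧ 0 < chainN (mU c k) (mL c k) S 12 (11 - i) y' ∧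
      ∃ p : (zdGraph 2).Walk y y', ∀ z ∈ p.support, z ∈ S ∧ (z ∈ mU c k i ∨ z = y') := by
  have e1 : 12 - 1 - (11 - i) = i := by omega
  have e2 : 12 - i = (11 - i) + 1 := by omega
  rw [e2] at hpos
  have := exists_walk_of_chainN_pos (U := mU c k) (L := mL c k) (S := S) (n := 12) (mU_finite c k) (11 - i)
    (x := y) (by rw [e1]; exact ⟨hy, hyS⟩) hpos
  rw [e1] at this
  exact this

/-- **Four strip crossings in `S`.** If the killed chain is positive at a point of the start box
in `S`, then `S` contains a left–right crossing of the top strip `[-36k,36k] × [12k,36k]`, a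
bottom–top crossing of the right strip, a left–right crossing of the bottom strip and a bottom–top
crossing of the left strip (all relative to `c`). [folklore] -/
theorem exists_crossings_of_chainN_pos (hk : 0 < k) {x : Site 2} (hx : x ∈ mB c k) (hxS : x ∈ S)
    (hpos : 0 < chainN (mU c k) (mL c k) S 12 12 x) :
    (∃ (u v : Site 2) (σ : (zdGraph 2).Walk u v), u 0 = c 0 - 36 * k ∧ v 0 = c 0 + 36 * k ∧
      ∀ z ∈ σ.support, z ∈ S ∧ c 0 - 36 * k ≤ z 0 ∧ z 0 ≤ c 0 + 36 * k ∧ c 1 + 12 * k ≤ z 1 ∧ z 1 ≤ c 1 + 36 * k) ∧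
    (∃ (u v : Site 2) (σ : (zdGraph 2).Walk u v), u 1 = c 1 - 36 * k ∧ v 1 = c 1 + 36 * k ∧
      ∀ z ∈ σ.support, z ∈ S ∧ c 0 + 12 * k ≤ z 0 ∧ z 0 ≤ c 0 + 36 * k ∧ c 1 - 36 * k ≤ z 1 ∧ z 1 ≤ c 1 + 36 * k) ∧
    (∃ (u v : Site 2) (σ : (zdGraph 2).Walk u v), u 0 = c 0 - 36 * k ∧ v 0 = c 0 + 36 * k ∧
      ∀ z ∈ σ.support, z ∈ S ∧ c 0 - 36 * k ≤ z 0 ∧ z 0 ≤ c 0 + 36 * k ∧ c 1 - 36 * k ≤ z 1 ∧ z 1 ≤ c 1 - 12 * k) ∧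
    (∃ (u v : Site 2) (σ : (zdGraph 2).Walk u v), u 1 = c 1 - 36 * k ∧ v 1 = c 1 + 36 * k ∧
      ∀ z ∈ σ.support, z ∈ S ∧ c 0 - 36 * k ≤ z 0 ∧ z 0 ≤ c 0 - 12 * k ∧ c 1 - 36 * k ≤ z 1 ∧ z 1 ≤ c 1 + 36 * k) := by
  have hTU : ∀ {i : ℕ} (hi : i + 1 < 12) {y : Site 2}, y ∈ mL c k i → y ∈ mU c k (i + 1) :=
    fun {i} hi {y} hy => mT_subset_mU hi (mL_subset_mT hk (by omega) hy)
  -- the twelve steps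
  have hx0 : x ∈ mU c k 0 := mT_subset_mU (by decide) (mB_subset_mT_zero hk hx)
  obtain ⟨y1, hL1, hS1, hp1, -⟩ := iter_step (by decide : 0 < 12) hx0 hxS hpos
  obtain ⟨y2, hL2, hS2, hp2, -⟩ := iter_step (by decide : 1 < 12) (hTU (by decide) hL1) hS1 hp1
  obtain ⟨y3, hL3, hS3, hp3, p2, hw2⟩ := iter_step (by decide : 2 < 12) (hTU (by decide) hL2) hS2 hp2
  obtain ⟨y4, hL4, hS4, hp4, -⟩ := iter_step (by decide : 3 < 12) (hTU (by decide) hL3) hS3 hp3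
  obtain ⟨y5, hL5, hS5, hp5, -⟩ := iter_step (by decide : 4 < 12) (hTU (by decide) hL4) hS4 hp4
  obtain ⟨y6, hL6, hS6, hp6, p5, hw5⟩ := iter_step (by decide : 5 < 12) (hTU (by decide) hL5) hS5 hp5
  obtain ⟨y7, hL7, hS7, hp7, -⟩ := iter_step (by decide : 6 < 12) (hTU (by decide) hL6) hS6 hp6
  obtain ⟨y8, hL8, hS8, hp8, -⟩ := iter_step (by decide : 7 < 12) (hTU (by decide) hL7) hS7 hp7
  obtain ⟨y9, hL9, hS9, hp9, p8, hw8⟩ := iter_step (by decide : 8 < 12) (hTU (by decide) hL8) hS8 hp8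
  obtain ⟨y10, hL10, hS10, hp10, -⟩ := iter_step (by decide : 9 < 12) (hTU (by decide) hL9) hS9 hp9
  obtain ⟨y11, hL11, hS11, hp11, -⟩ := iter_step (by decide : 10 < 12) (hTU (by decide) hL10) hS10 hp10
  obtain ⟨y12, hL12, hS12, -, p11, hw11⟩ := iter_step (by decide : 11 < 12) (hTU (by decide) hL11) hS11 hp11
  -- coordinates of the landing points and of the supports
  simp only [mL, mU, maneuver, MStep.L, MStep.U, MStep.corner, rectInterior, Set.mem_setOf_eq,
    Matrix.cons_val_zero, Matrix.cons_val_one, show (1:ℕ) < 12 by decide, show (2:ℕ) < 12 by decide,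
    show (4:ℕ) < 12 by decide, show (5:ℕ) < 12 by decide, show (7:ℕ) < 12 by decide, show (8:ℕ) < 12 by decide,
    show (10:ℕ) < 12 by decide, show (11:ℕ) < 12 by decide, dif_pos] at hL2 hL3 hL5 hL6 hL8 hL9 hL11 hL12 hw2 hw5 hw8 hw11
  simp at hL2 hL3 hL5 hL6 hL8 hL9 hL11 hL12 hw2 hw5 hw8 hw11
  refine ⟨?_, ?_, ?_, ?_⟩
  · -- top strip from `p2 : y2 → y3`
    obtain ⟨u, v, σ, hu, hv, hsub, hσ⟩ := exists_subwalk_slab p2 0 (L := c 0 - 36 * k) (R := c 0 + 36 * k)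
      (by omega) (by omega) (by omega)
    refine ⟨u, v, σ, hu, hv, fun z hz => ?_⟩
    have h1 := hw2 z (hsub z hz); have h2 := hσ z hz
    refine ⟨h1.1, h2.1, h2.2, ?_, ?_⟩ <;> rcases h1.2 with h | rfl <;> omega
  · -- right strip from `p5 : y5 → y6`, reversed
    obtain ⟨u, v, σ, hu, hv, hsub, hσ⟩ := exists_subwalk_slab p5.reverse 1 (L := c 1 - 36 * k) (R := c 1 + 36 * k)
      (by omega) (by omega) (by omega)
    refine ⟨u, v, σ, hu, hv, fun z hz => ?_⟩
    have hz' : z ∈ p5.support := by have := hsub z hz; rwa [Walk.support_reverse, List.mem_reverse] at this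
    have h1 := hw5 z hz'; have h2 := hσ z hz
    refine ⟨h1.1, ?_, ?_, h2.1, h2.2⟩ <;> rcases h1.2 with h | rfl <;> omega
  · -- bottom strip from `p8 : y8 → y9`, reversed
    obtain ⟨u, v, σ, hu, hv, hsub, hσ⟩ := exists_subwalk_slab p8.reverse 0 (L := c 0 - 36 * k) (R := c 0 + 36 * k)
      (by omega) (by omega) (by omega)
    refine ⟨u, v, σ, hu, hv, fun z hz => ?_⟩
    have hz' : z ∈ p8.support := by have := hsub z hz; rwa [Walk.support_reverse, List.mem_reverse] at this
    have h1 := hw8 z hz'; have h2 := hσ z hz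
    refine ⟨h1.1, h2.1, h2.2, ?_, ?_⟩ <;> rcases h1.2 with h | rfl <;> omega
  · -- left strip from `p11 : y11 → y12`
    obtain ⟨u, v, σ, hu, hv, hsub, hσ⟩ := exists_subwalk_slab p11 1 (L := c 1 - 36 * k) (R := c 1 + 36 * k)
      (by omega) (by omega) (by omega)
    refine ⟨u, v, σ, hu, hv, fun z hz => ?_⟩
    have h1 := hw11 z (hsub z hz); have h2 := hσ z hz
    refine ⟨h1.1, ?_, ?_, h2.1, h2.2⟩ <;> rcases h1.2 with h | rfl <;> omega

/-! ### The contradiction with hole-freeness -/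

/-- **Crossings in `S ⊆ K` around a face outside the hole-free `K` are impossible**: the face
escapes to infinity through `Kᶜ` (`HoleFree`), crossing one of the four strips transversally
(`exists_strip_crossing`), hence meeting the corresponding crossing (`exists_mem_support_of_crossing`)
at a site of `S ∩ Kᶜ = ∅`. [folklore] -/
theorem false_of_crossings {K : Set (Site 2)} (hK : HoleFree K) (hSK : S ⊆ K) (hk : 0 < k)
    {F₀ : Site 2} (hF₀ : F₀ ∉ K) (hF₀c : F₀ ∈ mB c k)
    (hT : ∃ (u v : Site 2) (σ : (zdGraph 2).Walk u v), u 0 = c 0 - 36 * k ∧ v 0 = c 0 + 36 * k ∧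
      ∀ z ∈ σ.support, z ∈ S ∧ c 0 - 36 * k ≤ z 0 ∧ z 0 ≤ c 0 + 36 * k ∧ c 1 + 12 * k ≤ z 1 ∧ z 1 ≤ c 1 + 36 * k)
    (hR : ∃ (u v : Site 2) (σ : (zdGraph 2).Walk u v), u 1 = c 1 - 36 * k ∧ v 1 = c 1 + 36 * k ∧
      ∀ z ∈ σ.support, z ∈ S ∧ c 0 + 12 * k ≤ z 0 ∧ z 0 ≤ c 0 + 36 * k ∧ c 1 - 36 * k ≤ z 1 ∧ z 1 ≤ c 1 + 36 * k)
    (hB : ∃ (u v : Site 2) (σ : (zdGraph 2).Walk u v), u 0 = c 0 - 36 * k ∧ v 0 = c 0 + 36 * k ∧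
      ∀ z ∈ σ.support, z ∈ S ∧ c 0 - 36 * k ≤ z 0 ∧ z 0 ≤ c 0 + 36 * k ∧ c 1 - 36 * k ≤ z 1 ∧ z 1 ≤ c 1 - 12 * k)
    (hLft : ∃ (u v : Site 2) (σ : (zdGraph 2).Walk u v), u 1 = c 1 - 36 * k ∧ v 1 = c 1 + 36 * k ∧
      ∀ z ∈ σ.support, z ∈ S ∧ c 0 - 36 * k ≤ z 0 ∧ z 0 ≤ c 0 - 12 * k ∧ c 1 - 36 * k ≤ z 1 ∧ z 1 ≤ c 1 + 36 * k) :
    False := by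
  -- the escaping face path
  obtain ⟨g', hg'1, hγ⟩ := hK F₀ hF₀ (c 1 + 36 * k)
  obtain ⟨γ, hγK⟩ := exists_walk_of_faceStep hγ hF₀
  obtain ⟨u', v', σ', hσ'sub, hcases⟩ := exists_strip_crossing (c := c) (B₁ := 12 * k) (B₃ := 36 * k) (by omega) γ hF₀c
    (Or.inr (by rw [le_abs]; left; linarith))
  have hσ'K : ∀ z ∈ σ'.support, z ∉ K := fun z hz => hγK z (hσ'sub z hz)
  rcases hcases with ⟨hu', hv', hσ'⟩ | ⟨hu', hv', hσ'⟩ | ⟨hu', hv', hσ'⟩ | ⟨hu', hv', hσ'⟩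
  · -- top strip: `σ'` bottom-to-top, against the left–right crossing `hT`
    obtain ⟨u, v, σ, hu, hv, hσ⟩ := hT
    obtain ⟨z, hzP, hzQ⟩ := Percolation.exists_mem_support_of_crossing (L := c 0 - 36 * k) (R := c 0 + 36 * k)
      (B := c 1 + 12 * k) (T := c 1 + 36 * k) σ σ' (fun z hz => (hσ z hz).2) (fun z hz => hσ' z hz) hu hv hu' hv'
    exact hσ'K z hzQ (hSK (hσ z hzP).1)
  · -- bottom strip
    obtain ⟨u, v, σ, hu, hv, hσ⟩ := hB
    obtain ⟨z, hzP, hzQ⟩ := Percolation.exists_mem_support_of_crossing (L := c 0 - 36 * k) (R := c 0 + 36 * k)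
      (B := c 1 - 36 * k) (T := c 1 - 12 * k) σ σ' (fun z hz => (hσ z hz).2) (fun z hz => hσ' z hz) hu hv hu' hv'
    exact hσ'K z hzQ (hSK (hσ z hzP).1)
  · -- right strip: `σ'` left-to-right, against the bottom–top crossing `hR`
    obtain ⟨u, v, σ, hu, hv, hσ⟩ := hR
    obtain ⟨z, hzP, hzQ⟩ := Percolation.exists_mem_support_of_crossing (L := c 0 + 12 * k) (R := c 0 + 36 * k)
      (B := c 1 - 36 * k) (T := c 1 + 36 * k) σ' σ (fun z hz => hσ' z hz) (fun z hz => (hσ z hz).2) hu' hv' hu hv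
    exact hσ'K z hzP (hSK (hσ z hzQ).1)
  · -- left strip
    obtain ⟨u, v, σ, hu, hv, hσ⟩ := hLft
    obtain ⟨z, hzP, hzQ⟩ := Percolation.exists_mem_support_of_crossing (L := c 0 - 36 * k) (R := c 0 - 12 * k)
      (B := c 1 - 36 * k) (T := c 1 + 36 * k) σ' σ (fun z hz => hσ' z hz) (fun z hz => (hσ z hz).2) hu' hv' hu hv
    exact hσ'K z hzP (hSK (hσ z hzQ).1)

/-! ### The one-annulus estimate -/

/-- **The one-annulus estimate (analytic weak Beurling, one scale).** Let `K ⊆ ℤ²` be hole-free,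
`S ⊆ K`, and let some face `F₀ ∉ K` lie in the box of radius `12k` about `c`. Then for every `x`
in that box, the solution of the Dirichlet problem on `S ∩ [c-48k, c+48k]²` with boundary values
`1` on `Sᶜ` inside the box and `0` outside the box is at least the universal constant
`maneuverConst > 0` at `x`: the walk from `x` is killed on `Sᶜ` before leaving the box of radius
`48k` with probability at least `c_*`. [cite: Smirnov2010, Lemma B.2 (weak Beurling, after Kesten)] -/
theorem maneuverConst_le_killedIn {K : Set (Site 2)} (hK : HoleFree K) (hSK : S ⊆ K) (hk : 0 < k)
    {F₀ : Site 2} (hF₀ : F₀ ∉ K) (hF₀c : F₀ ∈ mB c k) {x : Site 2} (hx : x ∈ mB c k) :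
    maneuverConst ≤ killedIn S (mW c k) x := by
  by_cases hxS : x ∈ S
  · have hIII := chainM_sub_chainN_le_killedIn (U := mU c k) (L := mL c k) (S := S) (n := 12) (mU_finite c k)
      (mW_finite c k) (mU_subset_mW) (mL_subset_mW hk) (disjoint_mU_mL) 12 x
    have hII := maneuverConst_le_chainM hk hx (c := c)
    have hI : chainN (mU c k) (mL c k) S 12 12 x = 0 := by
      by_contra hne
      have hpos : 0 < chainN (mU c k) (mL c k) S 12 12 x :=
        lt_of_le_of_ne (chainN_mem_Icc (mU_finite c k) 12 x).1 (Ne.symm hne)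
      obtain ⟨hT, hR, hB, hL⟩ := exists_crossings_of_chainN_pos hk hx hxS hpos
      exact false_of_crossings hK hSK hk hF₀ hF₀c hT hR hB hL
    rw [hI, sub_zero] at hIII
    exact hII.trans hIII
  · rw [killedIn_of_mem_diff (mW_finite c k) (mB_subset_mW hx) hxS]
    exact maneuverConst_le_one

end Geometry

end Literature.Probability.LatticeModels
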